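import Literature.ModelTheory.PseudofiniteFields.SmoothLocusDimension
import Literature.ModelTheory.PseudofiniteFields.DefinableTranslateRecurrenceLC
import Literature.ModelTheory.PseudofiniteFields.EtaleOpenTopologyProofs
import Literature.ModelTheory.PseudofiniteFields.DefinableSetsFiniteFieldsDecomposition
import Literature.ModelTheory.PseudofiniteFields.DefinableSetsFiniteFieldsProp33Proofs
import HarnessLib

/-!
# Translate recurrence for definable sets over finite fields, from the étale-open facts

Topic `Literature/ModelTheory/PseudofiniteFields`.  We PROVE the registered statement
`DefinableTranslateRecurrenceLC` of this directory ("H": for ring formulas `τ(w; y)`, `α(v; y')`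
there are `Q, K, C, c > 0` such that over every finite field `F` of characteristic `≥ Q`, for
every `y` there is `E ⊆ F^m`, `|E| ≤ C|F|^{m−1}`, with: for all `y'`, `T = τ(F^m; y)`,
`A = α(F^m; y')`, if `|A| > K` then every `t ∈ T ∖ E` has at least `c|A|²` pairs
`(a₀, a) ∈ A²` with `t + a − a₀ ∈ T`) CONDITIONALLY on the three published named facts

* `JohnsonTranWalsbergYe2024_thm71_psf` ([JohnsonTranWalsbergYe2024, Thm 7.1] for pseudo-finite
  fields), `WalsbergYe2023_thmC_psf` ([WalsbergYe2023, Thm C (1), Thm D]),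
* `ChatzidakisVanDenDriesMacintyre1992_mainTheorem` ([ChatzidakisVanDenDriesMacintyre1992, Main
  Theorem]; itself proved in the tree from their Prop. (2.7) and (3.3)):

`DefinableTranslateRecurrenceLC_of_facts`.  The statement was posed in this tree (crux
`PairwiseCurvedTilingsLC` of the route MatrixMultiplication/DefinableSTPPDichotomy) with a
derivation SKETCH through Galois stratification and uniform Chebotarev; no publication states it.
The proof given here is different and rests on the dimension theory of definable sets over
pseudo-finite fields developed in `CountingDimension*.lean` and `SmoothLocusDimension.lean`.

## Proof

Write `Fib_t(a₀) = {a ∈ A | t + a − a₀ ∈ T}` (so the pair count is `Σ_{a₀ ∈ A} |Fib_t(a₀)|`)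
and `Exc_e(t) = {a₀ ∈ A | dim Fib_t(a₀) < e}`.

1. PSEUDO-FINITE `K` (`not_dimAtLeast_exc_psf`): if `t` is étale-interior in `T` (a basic
   neighbourhood `O ∋ t` inside `T`), then `dim Exc_e(t) < e` for every `e ≥ 1`.  Indeed,
   decompose `Exc_e(t)` by Walsberg–Ye; if it had dimension `≥ e`, some piece `X_i` would
   (finite unions split, `CountingDimension.lean`), necessarily an étale-open subset of a locus
   `V_i` of codimension `c_i` with `e ≤ m − c_i` (`SmoothDatum.not_dimAtLeast_locus`); for
   `a₀ ∈ X_i` the set `X_i ∩ (O + a₀ − t)` is étale-open in `V_i`, contains `a₀`, and lies in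
   `Fib_t(a₀)`, which therefore has dimension `≥ m − c_i ≥ e` (`SmoothDatum.dimAtLeast_of_isEtaleOpenIn`,
   using Thm 7.1) — contradicting `a₀ ∈ Exc_e(t)`.
2. FIRST ORDER: with the dimension formulas of `CountingDimensionDefinable.lean` (thresholds good
   in all finite fields, agreement with the intrinsic dimension in pseudo-finite fields),
   "`dim Exc_e(t) < e` for `e = 1..m`" is one ring formula `GOOD(t, y, y')`, and "there is a
   non-zero box polynomial of degree `≤ N` off which every `t ∈ T` is GOOD for all `y'`" is one
   ring formula `θ_N(y)`, true in every pseudo-finite field for some `N` (generic points of `T`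
   are étale-interior, `GenericEtaleInterior.lean`); compactness makes `N` uniform and transfer
   moves `⋁_{k ≤ N} θ_k` to all finite fields with `|F| ≥ q₀` (`UniformBound.lean`,
   `FiniteFieldTheory.lean`).
3. FINITE `F` (counting, `CountingDimensionThresholds.lean`): `E :=` zeros of the box polynomial
   (`|E| ≤ mN|F|^{m−1}`, Schwartz–Zippel).  For `t ∈ T ∖ E` and `|A| > K := M_A`: let `e` be the
   thresholded dimension of `A`, so `δ_A^m q^e ≤ |A| ≤ M_A q^e`, `e ≥ 1`; GOOD gives
   `|Exc_e(t)| ≤ M_E q^{e−1} ≤ |A|/2` (for `q ≥ 2M_E/δ_A^m`), and `|Fib_t(a₀)| ≥ δ_F^m q^e` for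
   `a₀ ∉ Exc_e(t)`; hence `Σ_{a₀} |Fib_t(a₀)| ≥ (δ_A^m/2) q^e · δ_F^m q^e ≥ c|A|²`,
   `c = δ_A^m δ_F^m / (2 M_A²)`.

## References

* [JohnsonTranWalsbergYe2024] W. Johnson, C.-M. Tran, E. Walsberg, J. Ye, The étale-open topology
  and the stable fields conjecture, J. Eur. Math. Soc. 26 (2024) 4033–4070, Thm 7.1, Thm A.
* [WalsbergYe2023] E. Walsberg, J. Ye, Éz fields, J. Algebra 614 (2023) 611–649, Thm C (1), Thm D.
* [ChatzidakisVanDenDriesMacintyre1992] Z. Chatzidakis, L. van den Dries, A. Macintyre, Definable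
  sets over finite fields, J. reine angew. Math. 427 (1992) 107–135, Main Theorem, (2.7), §3.
-/

namespace Literature.ModelTheory.PseudofiniteFields

open FirstOrder FirstOrder.Language FirstOrder.Ring MvPolynomial

/-! ### The families: fibres and exceptional sets, as formulas -/

section Families

variable {m n n' : ℕ}

/-- **The fibre family** `Fib_t(a₀) = {a ∈ α(·; y') | t + a − a₀ ∈ τ(·; y)}` is ONE ring formula
with set variable `a` and parameters `(a₀, t, y, y')`. [folklore] -/
theorem exists_fibFormula (τ : Language.ring.Formula (Fin m ⊕ Fin n))
    (α : Language.ring.Formula (Fin m ⊕ Fin n')) :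
    ∃ φ : Language.ring.Formula (Fin m ⊕ (Fin m ⊕ (Fin m ⊕ (Fin n ⊕ Fin n')))),
      ∀ (K : Type) [Field K] [CompatibleRing K] (a₀ t : Fin m → K) (y : Fin n → K)
        (y' : Fin n' → K),
        defSet φ K (Sum.elim a₀ (Sum.elim t (Sum.elim y y'))) =
          {a | α.Realize (Sum.elim a y') ∧ τ.Realize (Sum.elim (t + a - a₀) y)} := by
  obtain ⟨φ, hφ⟩ := definable_and
    (definable_realize₂ α (Sum.inl : Fin m → Fin m ⊕ (Fin m ⊕ (Fin m ⊕ (Fin n ⊕ Fin n'))))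
      fun j => Sum.inr (Sum.inr (Sum.inr (Sum.inr j))))
    (definable_realize₂_add_sub τ
      (fun i => (Sum.inr (Sum.inr (Sum.inl i)) : Fin m ⊕ (Fin m ⊕ (Fin m ⊕ (Fin n ⊕ Fin n')))))
      Sum.inl (fun i => Sum.inr (Sum.inl i)) fun j => Sum.inr (Sum.inr (Sum.inr (Sum.inl j))))
  refine ⟨φ, fun K _ _ a₀ t y y' => Set.ext fun a => ?_⟩
  rw [mem_defSet, hφ]
  exact Iff.rfl

/-- **The exceptional family** `{a₀ ∈ α(·; y') | ¬ θ(a₀, t, y, y')}` (for a formula `θ` in the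
parameters of the fibre family — its dimension formula) is ONE ring formula with set variable `a₀`
and parameters `((t, y), y')`. [folklore] -/
theorem exists_excFormula (α : Language.ring.Formula (Fin m ⊕ Fin n'))
    (θ : Language.ring.Formula (Fin m ⊕ (Fin m ⊕ (Fin n ⊕ Fin n')))) :
    ∃ φ : Language.ring.Formula (Fin m ⊕ ((Fin m ⊕ Fin n) ⊕ Fin n')),
      ∀ (K : Type) [Field K] [CompatibleRing K] (t : Fin m → K) (y : Fin n → K) (y' : Fin n' → K),
        defSet φ K (Sum.elim (Sum.elim t y) y') =
          {a₀ | α.Realize (Sum.elim a₀ y') ∧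
            ¬ θ.Realize (Sum.elim a₀ (Sum.elim t (Sum.elim y y')))} := by
  obtain ⟨φ, hφ⟩ := definable_and
    (definable_realize₂ α (Sum.inl : Fin m → Fin m ⊕ ((Fin m ⊕ Fin n) ⊕ Fin n'))
      fun j => Sum.inr (Sum.inr j))
    (definable_not (definable_realize₁ θ
      (Sum.elim (Sum.inl : Fin m → Fin m ⊕ ((Fin m ⊕ Fin n) ⊕ Fin n'))
        (Sum.elim (fun i => Sum.inr (Sum.inl (Sum.inl i)))
          (Sum.elim (fun j => Sum.inr (Sum.inl (Sum.inr j))) fun j => Sum.inr (Sum.inr j))))))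
  refine ⟨φ, fun K _ _ t y y' => Set.ext fun a₀ => ?_⟩
  rw [mem_defSet, hφ, Set.mem_setOf_eq]
  refine and_congr Iff.rfl (not_congr (Iff.of_eq (congrArg θ.Realize (funext fun b => ?_))))
  rcases b with b | b | b | b <;> rfl

/-- **The encoding formula `θ_N(y)`**: "there is a non-zero box function `d` (exponents `≤ N`)
such that every `t ∈ τ(·; y)` with `Σ_β d_β t^β ≠ 0` satisfies, for every `y'` and every
`e < m`, `¬ θ^E_e((t, y), y')`". [folklore] -/
theorem exists_recurrenceFormula (m n n' N : ℕ) (τ : Language.ring.Formula (Fin m ⊕ Fin n))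
    (θE : Fin m → Language.ring.Formula ((Fin m ⊕ Fin n) ⊕ Fin n')) :
    ∃ θ : Language.ring.Formula (Fin n), ∀ (K : Type) [Field K] [CompatibleRing K]
      (y : Fin n → K), θ.Realize y ↔
        ∃ d : (Fin m → Fin (N + 1)) → K, d ≠ 0 ∧
          ∀ t : Fin m → K, τ.Realize (Sum.elim t y) →
            ∑ β : Fin m → Fin (N + 1), d β * ∏ l : Fin m, t l ^ ((β l : ℕ)) ≠ 0 →
            ∀ (y' : Fin n' → K) (e : Fin m), ¬ (θE e).Realize (Sum.elim (Sum.elim t y) y') := by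
  refine definable_exists ?_
  refine definable_and (definable_vecNeZero _) ?_
  refine definable_forall ?_
  refine definable_imp (definable_realize₂ τ _ _) ?_
  refine definable_imp (definable_boxSum_ne_zero m N _ _) ?_
  refine definable_forall ?_
  refine definable_iInf fun e => ?_
  exact definable_not (definable_realize₃ (θE e) _ _ _)

/-- Walsberg–Ye decomposition of a definable set with an arbitrary finite parameter type.
[cite: WalsbergYe2023, Thm D and Thm C (1)] -/
theorem WalsbergYe2023_thmC_psf.defSet (hWY : WalsbergYe2023_thmC_psf) (K : Type) [Field K]
    [CompatibleRing K] [Infinite K] (hK : K ⊨ finiteFieldTheory) {m : ℕ} {γ : Type} [Finite γ]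
    (φ : Language.ring.Formula (Fin m ⊕ γ)) (v : γ → K) :
    ∃ (k : ℕ) (c : Fin k → ℕ) (S : ∀ i, SmoothDatum K m (c i)) (X : Fin k → Set (Fin m → K)),
      defSet φ K v = ⋃ i, X i ∧
        ∀ i, (X i).Subsingleton ∨ (c i < m ∧ IsEtaleOpenIn K (S i).locus (X i)) := by
  obtain ⟨N, ⟨e⟩⟩ := Finite.exists_equiv_fin γ
  obtain ⟨k, c, S, X, hX, h⟩ := hWY K hK m N (φ.relabel (Sum.map id e)) (v ∘ e.symm)
  refine ⟨k, c, S, X, ?_, h⟩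
  rw [← hX]
  ext x
  rw [mem_defSet, Set.mem_setOf_eq, Formula.realize_relabel]
  refine Iff.of_eq (congrArg _ (funext fun i => ?_))
  rcases i with i | g
  · rfl
  · simp

end Families

/-! ### Step 1: the exceptional sets of an interior point are small (pseudo-finite fields) -/

section Psf

/-- **Exceptional sets of an étale-interior point are lower-dimensional** (pseudo-finite `K`;
facts: JTWY Thm 7.1, WY Thm C, CDM Main Theorem).  Let `T, A ⊆ K^m`, `t ∈ O ⊆ T` for a basic
étale-open `O`, and suppose the fibres `Fib_t(a₀) = {a ∈ A | t + a − a₀ ∈ T}` form a definable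
family in `a₀` and `Exc = {a₀ ∈ A | dim Fib_t(a₀) < e}` is definable, `e ≥ 1`.  Then
`dim Exc < e`. [folklore] (the argument is new; ingredients cited)
[cite: JohnsonTranWalsbergYe2024, Thm 7.1] [cite: WalsbergYe2023, Thm C (1) and Thm D]
[cite: ChatzidakisVanDenDriesMacintyre1992, Main Theorem] -/
theorem not_dimAtLeast_exc_psf (h71 : JohnsonTranWalsbergYe2024_thm71_psf)
    (hWY : WalsbergYe2023_thmC_psf) (hCDM : ChatzidakisVanDenDriesMacintyre1992_mainTheorem)
    (K : Type) [Field K] [CompatibleRing K] [Infinite K] (hK : K ⊨ finiteFieldTheory)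
    {m : ℕ} {T A : Set (Fin m → K)} {t : Fin m → K} {r : ℕ} (O : EtaleDatum K m r)
    (htO : t ∈ O.image) (hOT : O.image ⊆ T)
    {γF : Type} [Finite γF] (φF : Language.ring.Formula (Fin m ⊕ (Fin m ⊕ γF))) (vF : γF → K)
    (hφF : ∀ a₀, defSet φF K (Sum.elim a₀ vF) = {a | a ∈ A ∧ t + a - a₀ ∈ T})
    {e : ℕ} (he : 1 ≤ e)
    {γE : Type} [Finite γE] (φE : Language.ring.Formula (Fin m ⊕ γE)) (vE : γE → K)
    (hφE : defSet φE K vE = {a₀ | a₀ ∈ A ∧ ¬ DimAtLeast m {a | a ∈ A ∧ t + a - a₀ ∈ T} e}) :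
    ¬ DimAtLeast m (defSet φE K vE) e := by
  intro hdim
  -- decompose `Exc` and find a piece of dimension `≥ e`, necessarily open in a locus
  obtain ⟨k, c, S, X, hEX, hX⟩ := hWY.defSet K hK φE vE
  rw [hEX] at hdim
  obtain ⟨i, hi⟩ := exists_dimAtLeast_of_iUnion hdim
  have hinf : (X i).Infinite := (dimAtLeast_one_iff _).1 (hi.anti he)
  obtain ⟨hci, hopen⟩ := (hX i).resolve_left fun hs => hinf hs.finite
  -- `e ≤ m - c i` by the dimension bound for the locus
  have hle : e ≤ m - c i := by
    by_contra hlt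
    push Not at hlt
    exact SmoothDatum.not_dimAtLeast_locus K hCDM hK (m - c i) (S i) (by omega)
      ((hi.anti hlt).mono hopen.1)
  -- a point `a₀` of the piece and the translated neighbourhood
  obtain ⟨a₀, ha₀⟩ := hi.nonempty
  have ha₀E : a₀ ∈ defSet φE K vE := by rw [hEX]; exact Set.mem_iUnion.2 ⟨i, ha₀⟩
  obtain ⟨O', hO'⟩ := O.exists_image_eq_translate (t - a₀)
  have hX' : IsEtaleOpenIn K (S i).locus (X i ∩ O'.image) := hopen.inter_image O'
  have ha₀X' : a₀ ∈ X i ∩ O'.image := by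
    refine ⟨ha₀, ?_⟩
    rw [hO', Set.mem_setOf_eq, add_sub_cancel]
    exact htO
  -- `X i ∩ O' ⊆ Fib_t(a₀)`
  have hXE : X i ⊆ defSet φE K vE := by rw [hEX]; exact Set.subset_iUnion X i
  have hsub : X i ∩ O'.image ⊆ defSet φF K (Sum.elim a₀ vF) := by
    rintro a ⟨haX, haO'⟩
    rw [hφF]
    have haE := hXE haX
    rw [hφE] at haE
    refine ⟨haE.1, hOT ?_⟩
    rw [hO'] at haO'
    have : t + a - a₀ = a + (t - a₀) := by abel
    rw [this]
    exact haO'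
  -- so `Fib_t(a₀)` has dimension `≥ m - c i ≥ e`, contradicting `a₀ ∈ Exc`
  have hFib := SmoothDatum.dimAtLeast_of_isEtaleOpenIn K hCDM h71 hK (m - c i) (S i) (by omega)
    hX' ⟨a₀, ha₀X'⟩ φF (Sum.elim a₀ vF) hsub
  rw [hφF] at hFib
  rw [hφE] at ha₀E
  exact ha₀E.2 (hFib.anti hle)

/-- **The encoding formula holds at interior points (pseudo-finite fields).**  With the fibre
family `φF` (thresholds `CsF` good in all finite fields, dimension formulas `θF_e` for
`dim ≥ e + 1`), the exceptional families `φE_e` and their dimension formulas `θE_e`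
(`dim ≥ e + 1`, thresholds `CsE`): for every `y` there are `N` and a non-zero box function `d`
(the coefficients of the generic-interior polynomial of `T = τ(K^m; y)`) such that every `t ∈ T`
with `Σ d_β t^β ≠ 0` has `¬ θE_e((t, y), y')` for all `y'` and all `e < m`. [folklore]
[cite: JohnsonTranWalsbergYe2024, Thm 7.1] [cite: WalsbergYe2023, Thm C (1) and Thm D]
[cite: ChatzidakisVanDenDriesMacintyre1992, Main Theorem and (2.7)] -/
theorem recurrenceSem_psf (h71 : JohnsonTranWalsbergYe2024_thm71_psf)
    (hWY : WalsbergYe2023_thmC_psf) (hCDM : ChatzidakisVanDenDriesMacintyre1992_mainTheorem)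
    {m n n' : ℕ} (hm : 0 < m) (τ : Language.ring.Formula (Fin m ⊕ Fin n))
    (α : Language.ring.Formula (Fin m ⊕ Fin n'))
    (φF : Language.ring.Formula (Fin m ⊕ (Fin m ⊕ (Fin m ⊕ (Fin n ⊕ Fin n')))))
    (hφF : ∀ (K : Type) [Field K] [CompatibleRing K] (a₀ t : Fin m → K) (y : Fin n → K)
      (y' : Fin n' → K), defSet φF K (Sum.elim a₀ (Sum.elim t (Sum.elim y y'))) =
        {a | α.Realize (Sum.elim a y') ∧ τ.Realize (Sum.elim (t + a - a₀) y)})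
    {CsF : ℕ → ℕ} {δF : ℝ} (hδF : 0 < δF)
    (hgoodF : ∀ (F : Type) [Field F] [Fintype F] [CompatibleRing F]
      (v : Fin m ⊕ (Fin m ⊕ (Fin n ⊕ Fin n')) → F), GoodThresholds CsF δF m (defSet φF F v))
    (θF : Fin m → Language.ring.Formula (Fin m ⊕ (Fin m ⊕ (Fin n ⊕ Fin n'))))
    (hθF : ∀ (e : Fin m) (K : Type) [Field K] [CompatibleRing K]
      (v : Fin m ⊕ (Fin m ⊕ (Fin n ⊕ Fin n')) → K),
      (θF e).Realize v ↔ CDimAtLeast CsF m (defSet φF K v) (e + 1))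
    (φE : Fin m → Language.ring.Formula (Fin m ⊕ ((Fin m ⊕ Fin n) ⊕ Fin n')))
    (hφE : ∀ (e : Fin m) (K : Type) [Field K] [CompatibleRing K] (t : Fin m → K) (y : Fin n → K)
      (y' : Fin n' → K), defSet (φE e) K (Sum.elim (Sum.elim t y) y') =
        {a₀ | α.Realize (Sum.elim a₀ y') ∧
          ¬ (θF e).Realize (Sum.elim a₀ (Sum.elim t (Sum.elim y y')))})
    {CsE : ℕ → ℕ} {δE : ℝ} (hδE : 0 < δE)
    (hgoodE : ∀ (e : Fin m) (F : Type) [Field F] [Fintype F] [CompatibleRing F]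
      (v : (Fin m ⊕ Fin n) ⊕ Fin n' → F), GoodThresholds CsE δE m (defSet (φE e) F v))
    (θE : Fin m → Language.ring.Formula ((Fin m ⊕ Fin n) ⊕ Fin n'))
    (hθE : ∀ (e : Fin m) (K : Type) [Field K] [CompatibleRing K] (v : (Fin m ⊕ Fin n) ⊕ Fin n' → K),
      (θE e).Realize v ↔ CDimAtLeast CsE m (defSet (φE e) K v) (e + 1))
    (K : Type) [Field K] [CompatibleRing K] [Infinite K] (hK : K ⊨ finiteFieldTheory)
    (y : Fin n → K) :
    ∃ (N : ℕ) (d : (Fin m → Fin (N + 1)) → K), d ≠ 0 ∧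
      ∀ t : Fin m → K, τ.Realize (Sum.elim t y) →
        ∑ β : Fin m → Fin (N + 1), d β * ∏ l : Fin m, t l ^ ((β l : ℕ)) ≠ 0 →
        ∀ (y' : Fin n' → K) (e : Fin m), ¬ (θE e).Realize (Sum.elim (Sum.elim t y) y') := by
  -- decompose `T = τ(K^m; y)` and take the generic-interior polynomial
  obtain ⟨kT, cT, ST, XT, hTX, hXT⟩ := hWY K hK m n τ y
  obtain ⟨D, hD0, hD⟩ := exists_ne_zero_forall_etaleNhd_of_iUnion hm ST XT hXT
  obtain ⟨d, hd0, hdev⟩ := exists_box_of_ne_zero D hD0 le_rfl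
  refine ⟨D.totalDegree, d, hd0, fun t ht hbox y' e hθ => ?_⟩
  have htD : eval t D ≠ 0 := by rw [← hdev t]; exact hbox
  have htT : t ∈ ⋃ i, XT i := by rw [← hTX]; exact ht
  obtain ⟨r, O, htO, hOT⟩ := hD t htT htD
  rw [← hTX] at hOT
  -- `θE_e` says `dim Exc_{e+1}(t) ≥ e + 1`; contradiction with step 1
  rw [hθE, ← dimAtLeast_iff_cDimAtLeast K hK m (φE e) hδE (hgoodE e) _ (e + 1)] at hθ
  refine not_dimAtLeast_exc_psf h71 hWY hCDM K hK (T := defSet τ K y) (A := defSet α K y') O htO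
    hOT φF (Sum.elim t (Sum.elim y y')) (fun a₀ => ?_) (Nat.succ_le_succ (Nat.zero_le _))
    (φE e) (Sum.elim (Sum.elim t y) y') ?_ hθ
  · rw [hφF]
    rfl
  · rw [hφE]
    ext a₀
    simp only [Set.mem_setOf_eq, mem_defSet]
    refine and_congr Iff.rfl (not_congr ?_)
    rw [hθF, ← dimAtLeast_iff_cDimAtLeast K hK m φF hδF hgoodF _ (e + 1), hφF]

end Psf

/-! ### The theorem over finite fields -/

section Main

/-- Counting pairs by the first coordinate: the number of `(a₀, a) ∈ A²` with `P a₀ a` is the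
sum over `a₀` of the sizes of the fibres. [folklore] -/
theorem card_filter_product_eq_sum {X : Type*} (A : Finset X) (P : X → X → Prop)
    [DecidablePred fun p : X × X => P p.1 p.2] :
    (((A ×ˢ A).filter fun p : X × X => P p.1 p.2).card : ℝ) =
      ∑ a₀ ∈ A, (({a | a ∈ (A : Set X) ∧ P a₀ a} : Set X).ncard : ℝ) := by
  rw [Finset.card_filter, Finset.sum_product]
  push_cast
  refine Finset.sum_congr rfl fun a₀ _ => ?_
  rw [Finset.sum_boole, ← Set.ncard_coe_finset, Finset.coe_filter]
  rfl

/-- **Translate recurrence for definable sets over finite fields of large characteristic, from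
the étale-open facts** (`DefinableTranslateRecurrenceLC`, conditionally on JTWY Thm 7.1 and
WY Thm C for pseudo-finite fields and on the CDM Main Theorem). [folklore] (the statement is
posed in this tree; the proof is the one described in the module docstring)
[cite: JohnsonTranWalsbergYe2024, Thm 7.1] [cite: WalsbergYe2023, Thm C (1) and Thm D]
[cite: ChatzidakisVanDenDriesMacintyre1992, Main Theorem and (2.7)] -/
theorem DefinableTranslateRecurrenceLC_of_facts (h71 : JohnsonTranWalsbergYe2024_thm71_psf)
    (hWY : WalsbergYe2023_thmC_psf) (hCDM : ChatzidakisVanDenDriesMacintyre1992_mainTheorem) :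
    DefinableTranslateRecurrenceLC := by
  intro m n n' τ α
  classical
  rcases Nat.eq_zero_or_pos m with rfl | hm
  · -- `m = 0`: `F^0` is one point, so `|A| ≤ 1` and the hypothesis `1 < |A|` never holds
    refine ⟨0, 1, 0, 1, one_pos, fun F _ _ _ _ y => ⟨∅, by simp, ?_⟩⟩
    intro y' T A _ _ hKA
    exfalso
    have hA1 : A.card ≤ 1 :=
      (Finset.card_le_univ A).trans (by rw [Fintype.card_fun, Fintype.card_fin, pow_zero])
    omega
  -- (1) the families, their thresholds and dimension formulas
  obtain ⟨φF, hφF⟩ := exists_fibFormula τ α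
  obtain ⟨CsA, δA, hδA, hδA1, hgoodA⟩ := exists_goodThresholds₁ hCDM α
  obtain ⟨CsF, δF, hδF, hδF1, hgoodF⟩ := exists_goodThresholds₁ hCDM φF
  choose θF hθF using fun e : Fin m => exists_formula_cDimAtLeast CsF m φF (e + 1)
  choose φE hφE using fun e : Fin m => exists_excFormula (n := n) α (θF e)
  obtain ⟨CsE, δE, hδE, hδE1, hgoodE⟩ := exists_goodThresholds hCDM m φE
  choose θE hθE using fun e : Fin m => exists_formula_cDimAtLeast CsE m (φE e) (e + 1)
  -- (2) the encoding formulas and their truth in pseudo-finite fields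
  choose θ hθ using fun N => exists_recurrenceFormula m n n' N τ θE
  have hpw : ∀ (K : Type) [Field K] [CompatibleRing K] [Infinite K], K ⊨ finiteFieldTheory →
      ∀ y : Fin n → K, ∃ N, (θ N).Realize y := by
    intro K _ _ _ hK y
    obtain ⟨N, d, hd0, hd⟩ := recurrenceSem_psf h71 hWY hCDM hm τ α φF hφF hδF hgoodF θF hθF φE
      hφE hδE hgoodE θE hθE K hK y
    exact ⟨N, (hθ N K y).2 ⟨d, hd0, hd⟩⟩
  -- (3) a uniform index and the transfer to large finite fields
  obtain ⟨N₀, hN₀⟩ := FiniteField.exists_uniform_bound_of_pseudoFinite θ hpw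
  set ψ : Language.ring.Formula (Fin n) := Formula.iSup fun k : Fin (N₀ + 1) => θ k with hψ
  have hψK : ∀ (K : Type) [Field K] [CompatibleRing K] [Infinite K], K ⊨ finiteFieldTheory →
      ∀ y : Fin n → K, ψ.Realize y := by
    intro K _ _ _ hK y
    obtain ⟨k, hk, hreal⟩ := hN₀ K hK y
    rw [hψ, Formula.realize_iSup]
    exact ⟨⟨k, Nat.lt_succ_of_le hk⟩, hreal⟩
  obtain ⟨q₀, hq₀⟩ := FiniteField.eventually_realize_forall_of_pseudoFinite ψ hψK
  -- (4) the constants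
  set MA : ℕ := thresholdBound CsA m with hMA
  set ME : ℕ := thresholdBound CsE m with hME
  set Q₁ : ℕ := ⌈2 * (ME : ℝ) / δA ^ m⌉₊ with hQ₁
  have hMA1 : (1 : ℝ) ≤ MA := by exact_mod_cast one_le_thresholdBound CsA m
  have hMA0 : (0 : ℝ) < MA := by linarith
  have hc : 0 < δA ^ m * δF ^ m / (2 * (MA : ℝ) ^ 2) :=
    div_pos (mul_pos (pow_pos hδA m) (pow_pos hδF m)) (mul_pos two_pos (pow_pos hMA0 2))
  refine ⟨max q₀ Q₁, MA, ((m * N₀ : ℕ) : ℝ), δA ^ m * δF ^ m / (2 * (MA : ℝ) ^ 2), hc,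
    fun F _ _ instCR hchar y => ?_⟩
  -- (5) the finite field: `|F| ≥ char F ≥ max q₀ Q₁`
  have hcardQ : max q₀ Q₁ ≤ Fintype.card F := by
    refine hchar.trans ?_
    obtain ⟨k, _, hk⟩ := FiniteField.card F (ringChar F)
    rw [hk]
    exact Nat.le_self_pow k.ne_zero _
  have hψF : ψ.Realize y := by
    rw [realize_iff_of_compatibleRing]
    exact hq₀ F ((le_max_left _ _).trans hcardQ) y
  rw [hψ, Formula.realize_iSup] at hψF
  obtain ⟨k, hk⟩ := hψF
  obtain ⟨d, hd0, hd⟩ := (hθ k F y).1 hk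
  -- the exceptional set: the zeros of the box polynomial
  refine ⟨Finset.univ.filter fun w : Fin m → F =>
      ∑ β : Fin m → Fin (k + 1), d β * ∏ l : Fin m, w l ^ ((β l : ℕ)) = 0, ?_, ?_⟩
  · have hq0 : (0 : ℝ) ≤ (Fintype.card F : ℝ) ^ ((m : ℝ) - 1) := by positivity
    calc _ ≤ ((m * (k : ℕ) : ℕ) : ℝ) * (Fintype.card F : ℝ) ^ ((m : ℝ) - 1) :=
          card_filter_boxSum_eq_zero_le d hd0
      _ ≤ ((m * N₀ : ℕ) : ℝ) * (Fintype.card F : ℝ) ^ ((m : ℝ) - 1) := by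
          apply mul_le_mul_of_nonneg_right _ hq0
          exact_mod_cast Nat.mul_le_mul_left m (Nat.lt_succ_iff.1 k.2)
  intro y' T A hT hA hKA t ht htE
  have hτt : τ.Realize (Sum.elim t y) := (hT t).1 ht
  have hbox : ∑ β : Fin m → Fin (k + 1), d β * ∏ l : Fin m, t l ^ ((β l : ℕ)) ≠ 0 :=
    fun h0 => htE (Finset.mem_filter.2 ⟨Finset.mem_univ _, h0⟩)
  have hgood : ∀ e : Fin m, ¬ (θE e).Realize (Sum.elim (Sum.elim t y) y') := hd t hτt hbox y'
  -- (6) counting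
  set q : ℝ := (Fintype.card F : ℝ) with hq
  have hq0 : (0 : ℝ) < q := by rw [hq]; exact_mod_cast Fintype.card_pos
  have hQ₁q : (Q₁ : ℝ) ≤ q := by rw [hq]; exact_mod_cast (le_max_right _ _).trans hcardQ
  -- the set `A` and its thresholded dimension `e₀`
  have hXA : defSet α F y' = ↑A := Set.ext fun v => by rw [mem_defSet, Finset.mem_coe, hA v]
  have hAcard : ((defSet α F y').ncard : ℝ) = A.card := by rw [hXA, Set.ncard_coe_finset]
  have hgA := hgoodA F y'
  have hdim1 : CDimAtLeast CsA m (defSet α F y') 1 := by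
    by_contra h1
    have h2 := ncard_le_of_not_cDimAtLeast_one hgA h1
    rw [hAcard] at h2
    have h3 : (MA : ℝ) < A.card := by exact_mod_cast hKA
    exact absurd h2 (not_le.2 h3)
  have hm1 : 1 ≤ m := hdim1.le
  set e₀ : ℕ := Nat.findGreatest (fun e => CDimAtLeast CsA m (defSet α F y') e) m with he₀def
  have he₀ : CDimAtLeast CsA m (defSet α F y') e₀ :=
    Nat.findGreatest_spec (P := fun e => CDimAtLeast CsA m (defSet α F y') e) hm1 hdim1
  have h1e₀ : 1 ≤ e₀ :=
    Nat.le_findGreatest (P := fun e => CDimAtLeast CsA m (defSet α F y') e) hm1 hdim1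
  have he₀m : e₀ ≤ m := Nat.findGreatest_le m
  have hnot : ¬ CDimAtLeast CsA m (defSet α F y') (e₀ + 1) := by
    by_cases h : e₀ + 1 ≤ m
    · exact Nat.findGreatest_is_greatest (P := fun e => CDimAtLeast CsA m (defSet α F y') e)
        (Nat.lt_succ_self e₀) h
    · exact fun h' => h h'.le
  have hAup : (A.card : ℝ) ≤ MA * q ^ e₀ := by
    rw [← hAcard]; exact ncard_le_of_not_cDimAtLeast hgA hnot
  have hAlow : δA ^ m * q ^ e₀ ≤ A.card := by
    rw [← hAcard]; exact le_ncard_of_cDimAtLeast hδA hδA1 hgA he₀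
  -- the index `eF : Fin m` of `e₀`
  set eF : Fin m := ⟨e₀ - 1, by omega⟩ with heFdef
  have heF : (eF : ℕ) + 1 = e₀ := by
    show e₀ - 1 + 1 = e₀
    omega
  -- the exceptional set in `F` and its size
  set Exc : Set (Fin m → F) := defSet (φE eF) F (Sum.elim (Sum.elim t y) y') with hExcdef
  have hExc_dim : ¬ CDimAtLeast CsE m Exc ((eF : ℕ) + 1) := fun h =>
    hgood eF ((hθE eF F _).2 h)
  have hExc_card : (Exc.ncard : ℝ) ≤ ME * q ^ (eF : ℕ) :=
    ncard_le_of_not_cDimAtLeast (hgoodE eF F _) hExc_dim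
  have hmemExc : ∀ a₀, a₀ ∈ Exc ↔ a₀ ∈ A ∧
      ¬ CDimAtLeast CsF m (defSet φF F (Sum.elim a₀ (Sum.elim t (Sum.elim y y')))) e₀ := by
    intro a₀
    rw [hExcdef, hφE, Set.mem_setOf_eq, ← hA a₀, hθF, heF]
  -- the fibres and their sizes off `Exc`
  have hFib : ∀ a₀, defSet φF F (Sum.elim a₀ (Sum.elim t (Sum.elim y y'))) =
      {a | a ∈ (A : Set (Fin m → F)) ∧ t + a - a₀ ∈ T} := by
    intro a₀
    rw [hφF]
    ext a
    simp only [Set.mem_setOf_eq, Finset.mem_coe, hA a, hT (t + a - a₀)]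
  have hFib_low : ∀ a₀ ∈ A, a₀ ∉ Exc →
      δF ^ m * q ^ e₀ ≤ (({a | a ∈ (A : Set (Fin m → F)) ∧ t + a - a₀ ∈ T} : Set _).ncard : ℝ) := by
    intro a₀ ha₀ hnE
    have hdimF : CDimAtLeast CsF m (defSet φF F (Sum.elim a₀ (Sum.elim t (Sum.elim y y')))) e₀ := by
      by_contra h
      exact hnE ((hmemExc a₀).2 ⟨ha₀, h⟩)
    have := le_ncard_of_cDimAtLeast hδF hδF1 (hgoodF F _) hdimF
    rwa [hFib] at this
  -- (7) the estimate
  have hpairs := card_filter_product_eq_sum A (fun a₀ a => t + a - a₀ ∈ T)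
  -- `|A ∖ Exc| ≥ |A| - |Exc| ≥ (δA^m / 2) q^{e₀}`
  have hExc_small : (ME : ℝ) * q ^ (eF : ℕ) ≤ δA ^ m / 2 * q ^ e₀ := by
    have h1 : 2 * (ME : ℝ) / δA ^ m ≤ q := (Nat.le_ceil _).trans hQ₁q
    have hδAm : (0 : ℝ) < δA ^ m := pow_pos hδA m
    rw [div_le_iff₀ hδAm] at h1
    rw [← heF, pow_succ]
    have hqe : (0 : ℝ) ≤ q ^ (eF : ℕ) := pow_nonneg hq0.le _
    have h2 := mul_le_mul_of_nonneg_right h1 hqe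
    nlinarith [h2]
  set B : Finset (Fin m → F) := A.filter fun a₀ => a₀ ∉ Exc with hBdef
  have hBcard : δA ^ m / 2 * q ^ e₀ ≤ (B.card : ℝ) := by
    have hsplit : (((A.filter fun a₀ => a₀ ∈ Exc).card : ℕ) : ℝ) + B.card = A.card := by
      rw [hBdef]
      exact_mod_cast Finset.card_filter_add_card_filter_not (s := A) fun a₀ => a₀ ∈ Exc
    have hin : (((A.filter fun a₀ => a₀ ∈ Exc).card : ℕ) : ℝ) ≤ Exc.ncard := by
      have hsub : (↑(A.filter fun a₀ => a₀ ∈ Exc) : Set (Fin m → F)) ⊆ Exc := fun a₀ ha₀ => by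
        rw [Finset.mem_coe, Finset.mem_filter] at ha₀; exact ha₀.2
      have := Set.ncard_le_ncard hsub (Set.toFinite Exc)
      rw [Set.ncard_coe_finset] at this
      exact_mod_cast this
    linarith [hAlow, hExc_card, hExc_small]
  -- sum over `B ⊆ A`
  have hsum : (B.card : ℝ) * (δF ^ m * q ^ e₀) ≤
      ∑ a₀ ∈ A, (({a | a ∈ (A : Set (Fin m → F)) ∧ t + a - a₀ ∈ T} : Set _).ncard : ℝ) := by
    calc (B.card : ℝ) * (δF ^ m * q ^ e₀)
        = ∑ a₀ ∈ B, δF ^ m * q ^ e₀ := by rw [Finset.sum_const, nsmul_eq_mul]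
      _ ≤ ∑ a₀ ∈ B, (({a | a ∈ (A : Set (Fin m → F)) ∧ t + a - a₀ ∈ T} : Set _).ncard : ℝ) := by
          refine Finset.sum_le_sum fun a₀ ha₀ => ?_
          rw [hBdef, Finset.mem_filter] at ha₀
          exact hFib_low a₀ ha₀.1 ha₀.2
      _ ≤ ∑ a₀ ∈ A, (({a | a ∈ (A : Set (Fin m → F)) ∧ t + a - a₀ ∈ T} : Set _).ncard : ℝ) :=
          Finset.sum_le_sum_of_subset_of_nonneg (Finset.filter_subset _ _)
            fun _ _ _ => Nat.cast_nonneg _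
  -- conclusion
  have hqe : (A.card : ℝ) / MA ≤ q ^ e₀ := by
    rw [div_le_iff₀ hMA0]
    linarith [mul_comm (MA : ℝ) (q ^ e₀)]
  have hA0 : (0 : ℝ) ≤ A.card := Nat.cast_nonneg _
  have hfinal : δA ^ m * δF ^ m / (2 * (MA : ℝ) ^ 2) * (A.card : ℝ) ^ 2 ≤
      ∑ a₀ ∈ A, (({a | a ∈ (A : Set (Fin m → F)) ∧ t + a - a₀ ∈ T} : Set _).ncard : ℝ) := by
    calc δA ^ m * δF ^ m / (2 * (MA : ℝ) ^ 2) * (A.card : ℝ) ^ 2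
        = (δA ^ m / 2 * (A.card / MA)) * (δF ^ m * (A.card / MA)) := by
          field_simp
      _ ≤ (δA ^ m / 2 * q ^ e₀) * (δF ^ m * q ^ e₀) := by
          have h1 : (0 : ℝ) ≤ A.card / MA := div_nonneg hA0 hMA0.le
          have hδAm : (0 : ℝ) ≤ δA ^ m / 2 := by linarith [pow_pos hδA m]
          have hδFm : (0 : ℝ) ≤ δF ^ m := (pow_pos hδF m).le
          exact mul_le_mul (mul_le_mul_of_nonneg_left hqe hδAm) (mul_le_mul_of_nonneg_left hqe hδFm)
            (mul_nonneg hδFm h1) (mul_nonneg hδAm (pow_nonneg hq0.le _))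
      _ ≤ (B.card : ℝ) * (δF ^ m * q ^ e₀) :=
          mul_le_mul_of_nonneg_right hBcard (mul_nonneg (pow_pos hδF m).le (pow_nonneg hq0.le _))
      _ ≤ _ := hsum
  rw [← hpairs] at hfinal
  convert hfinal using 3

end Main

/-- **`DefinableTranslateRecurrenceLC` modulo the two remaining published inputs.**  With
Johnson–Tran–Walsberg–Ye's Theorem 7.1 for pseudo-finite fields now PROVED in the tree
(`JohnsonTranWalsbergYe2024_thm71_psf_holds`, `EtaleOpenTopologyProofs.lean`), the statement
follows from the éz decomposition `WalsbergYe2023_thmC_psf` ([WalsbergYe2023, Thm C (1), Thm D])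
and the Chatzidakis–van den Dries–Macintyre counting theorem alone.
[cite: WalsbergYe2023, Thm C (1) and Thm D] [cite: ChatzidakisVanDenDriesMacintyre1992, Main Theorem] -/
theorem DefinableTranslateRecurrenceLC_of_WY_of_CDM (hWY : WalsbergYe2023_thmC_psf)
    (hCDM : ChatzidakisVanDenDriesMacintyre1992_mainTheorem) : DefinableTranslateRecurrenceLC :=
  DefinableTranslateRecurrenceLC_of_facts JohnsonTranWalsbergYe2024_thm71_psf_holds hWY hCDM

/-- The same with the CDM Main Theorem unfolded into its two printed inputs, Prop. (3.3)
(Lang–Weil for affine algebraic sets) and Prop. (2.7) (the one-variable normal form for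
pseudo-finite fields): these three named facts are now the complete trust base of
`DefinableTranslateRecurrenceLC`.
[cite: ChatzidakisVanDenDriesMacintyre1992, Prop. (3.3), Prop. (2.7) and Thm. (3.7)]
[cite: WalsbergYe2023, Thm C (1) and Thm D] -/
theorem DefinableTranslateRecurrenceLC_of_WY_of_prop33_of_prop27 (hWY : WalsbergYe2023_thmC_psf)
    (h33 : ChatzidakisVanDenDriesMacintyre1992_prop33)
    (h27 : ChatzidakisVanDenDriesMacintyre1992_prop27) : DefinableTranslateRecurrenceLC :=
  DefinableTranslateRecurrenceLC_of_WY_of_CDM hWY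
    (ChatzidakisVanDenDriesMacintyre1992_mainTheorem_holds_of h33 h27)

/-- **`DefinableTranslateRecurrenceLC` modulo Walsberg–Ye Thm C (psf) and CDM Prop. (2.7) only**:
Prop. (3.3) (Lang–Weil for affine algebraic sets) is now PROVED in the tree
(`ChatzidakisVanDenDriesMacintyre1992_prop33_holds`, `DefinableSetsFiniteFieldsProp33Proofs.lean`).
[cite: WalsbergYe2023, Thm C (1) and Thm D] [cite: ChatzidakisVanDenDriesMacintyre1992, Prop. (2.7) and Thm. (3.7)] -/
theorem DefinableTranslateRecurrenceLC_of_WY_of_prop27 (hWY : WalsbergYe2023_thmC_psf)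
    (h27 : ChatzidakisVanDenDriesMacintyre1992_prop27) : DefinableTranslateRecurrenceLC :=
  DefinableTranslateRecurrenceLC_of_WY_of_prop33_of_prop27 hWY
    ChatzidakisVanDenDriesMacintyre1992_prop33_holds h27

end Literature.ModelTheory.PseudofiniteFields
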